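import HarnessLib
import Mathlib.Probability.Moments.Covariance
import Summits.QuantumFields.YangMills.Theorems.PencilRigidityHypercubicLimitDefs
import Summits.QuantumFields.YangMills.Theorems.LangevinControlUVOSLegsFromFemtoAndGapDefs
import Summits.QuantumFields.YangMills.Theorems.LangevinControlUVOSLegsFromFemtoAndGapStubAssemblyLatticeDist
import Summits.QuantumFields.YangMills.Theorems.LangevinControlUVOSLegsFromFemtoAndGapStubLowerTwoPointMain
import Summits.QuantumFields.YangMills.Theorems.LangevinControlUVOSLegsFromFemtoAndGapStubAssemblyLowDegree
import Summits.QuantumFields.YangMills.Theorems.LangevinControlUVOSLegsFromFemtoAndGapStubAssemblyPlaneStrings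

/-!
# Crux `HypercubicLimit` (stmt-QuantumFields-8646), line `conditional-mean-telescoping`: the scaled `Q2` floor (SG5)

`scaledQ2_lower_bound`: with `R₀ = ⌊δ₀/a⌋`, `N = rpSquare r β S R₀`, cone comparability (W2b) of `reflPair` at height `R₀` and the
a-uniform bound for 2-strings of plane weights ((U) at `n = 2`) yield ONE positive-time bump `v = v(δ₀, θ)` with `ε ≤ N⁻¹ a⁸ Q2(θv, v)`
on every admissible step.  Key identity `Cov(P_x, P_y) = reflPair(θ_ℤ x, y) + swap` (`torusDensity_timeReflect`: `P_{θ_ℤ x} ∘ Θ` is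
the reflected density `P̃_x`; `P_x − P̃_x` is a one-step temporal difference of the electric planes, `reflDensity_sub_torusDensity`).
Main term `≥ c N (ρ/2a)⁸` ((W2b) in the cone, Riemann mass of the plateaux); the swap, in 2-string weights, is after summation by
parts in `x` and the mean value theorem `a ×` a 2-string sum against the FIXED tensor `∂₀(v∘θ) ⊗ v ∈ ⁰𝒮` at points within `a` of the
lattice, so `O(a · a⁻⁸ N)` by (U).  Refs: `PencilRigidityHypercubicLimitDefs` §§0, 3, 7; OsterwalderSeiler1978 §§2–3; GlimmJaffe1987 §6.1.
-/

set_option autoImplicit false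

noncomputable section

open scoped SchwartzMap ENNReal LineDeriv ProbabilityTheory
open MeasureTheory Filter Topology
open Literature.MathematicalPhysics.AQFT Literature.MathematicalPhysics.QuantumLattice
open Literature.MathematicalPhysics.QuantumFieldTheory
open Literature.Probability.LatticeModels (box Site mem_box)
open Summit.QuantumFields.YangMills.Theorems.HypercubicLimit.Negative (torusPlaquette torusDensity rpSquare influence thetaZ
  reflDensity tensor₂ tensor₂_apply isTensorOf_tensor₂ isOffDiagonal_of_halfSpaces torusDensity_eq_sum torusDensity_timeReflect
  reflDensity_sub_torusDensity measurable_torusPlaquette thetaZ_apply_zero thetaZ_apply_of_ne)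
open Summit.QuantumFields.YangMills.Theorems.OSLegsFromFemtoAndGap (torusMomentStr latticeDistStr latticeDist torusE_comp_configShift sum_piFinset_two)
open Summit.QuantumFields.YangMills.Theorems.OSLegsFromFemtoAndGap.StubLower (exists_bump_schwartz pow_le_sum_box abs_apply_le_norm)
open Summit.QuantumFields.YangMills.Cruxes.OSLegsFromFemtoAndGap.DlrCollarTransfer (Q2 Q3 torusE dens)
open Summit.QuantumFields.YangMills.Cruxes.OSLegsFromFemtoAndGap.DlrCollarTransfer.StubLower (norm_timeReflection_sub_single mul_sum_mul_sum_le)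

namespace Summit.QuantumFields.YangMills.Cruxes.HypercubicLimit.ConditionalMeanTelescoping


variable {G : Type} [Group G] [TopologicalSpace G] [IsTopologicalGroup G] [CompactSpace G] [MeasurableSpace G] [BorelSpace G]

/-- `θ_ℤ` is an involution. -/
private theorem thetaZ_thetaZ (x : Site 4) : thetaZ (thetaZ x) = x := by
  ext k; by_cases hk : k = 0 <;> simp [thetaZ, hk]

omit [IsTopologicalGroup G] [CompactSpace G] [BorelSpace G] in
/-- Translation covariance: the origin plane field of the configuration translated by `−z` (periodic lift) is the plaquette at `z`. -/
private theorem planeObs_shift_lift (r : LatticeRep G) (L : ℕ) (q : Fin 4 × Fin 4) (z : Site 4) (U : GaugeConfig 4 L G) :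
    planeObs r q (configShift (-z) (torusLift L U)) = torusPlaquette r L q.1 q.2 z U := by
  unfold planeObs torusPlaquette
  rw [Theorems.CurvatureBoostCovariance.Negative.plaquetteObs_configShift_torusLift]
  unfold plaquetteObs
  rw [Theorems.CurvatureBoostCovariance.Negative.plaquetteHolonomyZd_torusLift']

/-- **The covariance of two torus plaquettes is the plane-string weight of the 2-string** (the torus mean of a plaquette is the
`wilsonTorusMean` of its origin plane field, by translation invariance of Wilson's measure). -/
private theorem covariance_torusPlaquette (r : LatticeRep G) (β : ℝ) (S : ℕ) (i j i' j' : Fin 4) (x y : Site 4) :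
    cov[torusPlaquette r (2 * S + 1) i j x, torusPlaquette r (2 * S + 1) i' j' y; wilsonMeasure (d := 4) (L := 2 * S + 1) r.ρ β] =
      planeWeight r β S ![(i, j), (i', j')] ![x, y] := by
  have hm : ∀ (q : Fin 4 × Fin 4) (z : Site 4), ∫ U, torusPlaquette r (2 * S + 1) q.1 q.2 z U
      ∂(wilsonMeasure (d := 4) (L := 2 * S + 1) r.ρ β) = wilsonTorusMean r.ρ β S (planeObs r q) := fun q z => by
    rw [← torusE_comp_configShift (G := G) r β S (planeObs r q) z]; unfold torusE
    simp only [Function.comp_apply, planeObs_shift_lift]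
  unfold ProbabilityTheory.covariance
  rw [hm (i, j) x, hm (i', j') y]
  unfold planeWeight torusMomentStr
  simp only [Fin.prod_univ_two, Matrix.cons_val_zero, Matrix.cons_val_one, planeObs_shift_lift]

/-- A torus plaquette is in `L²` of any finite measure (bounded by `N`, measurable). -/
private theorem memLp_torusPlaquette (r : LatticeRep G) (L : ℕ) (i j : Fin 4) (z : Site 4) (μ : Measure (GaugeConfig 4 L G))
    [IsFiniteMeasure μ] : MemLp (torusPlaquette r L i j z) 2 μ :=
  MemLp.of_bound (measurable_torusPlaquette r L i j z).aestronglyMeasurable r.N (Eventually.of_forall fun U => by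
    rw [Real.norm_eq_abs]; exact abs_plaquetteObs_le_holds (ρ := r.ρ) r.mem_unitary z i j _)

/-- The torus density and the reflected density (`P̃_z = P_{θ_ℤ z} ∘ Θ`) are in `L²` (bounded, measurable). -/
private theorem memLp_torusDensity (r : LatticeRep G) (L : ℕ) (z : Site 4) (μ : Measure (GaugeConfig 4 L G))
    [IsFiniteMeasure μ] : MemLp (torusDensity r L z) 2 μ ∧ MemLp (reflDensity r L z) 2 μ := by
  obtain ⟨C, hC⟩ := r.curvature.bounded
  have hm : ∀ w, Measurable (torusDensity r L w) := fun w =>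
    r.curvature.measurable.comp ((configShift _).measurable.comp (measurable_torusLift _))
  have hb : ∀ w U, ‖torusDensity r L w U‖ ≤ C := fun w U => by rw [Real.norm_eq_abs]; exact hC _
  refine ⟨MemLp.of_bound (hm z).aestronglyMeasurable C (Eventually.of_forall (hb z)), ?_⟩
  rw [show reflDensity r L z = fun U => torusDensity r L (thetaZ z) U.timeReflect from
    funext fun U => by rw [torusDensity_timeReflect, thetaZ_thetaZ]]
  exact MemLp.of_bound ((hm _).comp WilsonRP.measurable_timeReflect).aestronglyMeasurable C (Eventually.of_forall fun U => hb _ _)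

/-- Covariance against the torus density, expanded over the six planes `q = (i < j)`. -/
private theorem covariance_torusDensity_right (r : LatticeRep G) (L : ℕ) (μ : Measure (GaugeConfig 4 L G)) [IsFiniteMeasure μ]
    {X : GaugeConfig 4 L G → ℝ} (hX : MemLp X 2 μ) (y : Site 4) : cov[X, torusDensity r L y; μ] =
      ∑ q ∈ Finset.univ.filter (fun q : Fin 4 × Fin 4 => q.1 < q.2), cov[X, torusPlaquette r L q.1 q.2 y; μ] := by
  rw [show torusDensity r L y = fun U => ∑ q ∈ Finset.univ.filter (fun q : Fin 4 × Fin 4 => q.1 < q.2),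
      torusPlaquette r L q.1 q.2 y U from funext fun U => by
        rw [torusDensity_eq_sum, Finset.sum_filter, ← Finset.univ_product_univ, Finset.sum_product],
    ProbabilityTheory.covariance_fun_sum_right' (fun q _ => memLp_torusPlaquette r L q.1 q.2 y μ) hX]

/-- The Θ-swap in covariance form: `Cov(P_x, Z) − Cov(P̃_x, Z) = Σ_{j>0} (Cov(E_j(x), Z) − Cov(E_j(x − e₀), Z))`. -/
private theorem covariance_torusDensity_sub (r : LatticeRep G) (L : ℕ) (μ : Measure (GaugeConfig 4 L G)) [IsFiniteMeasure μ]
    {Z : GaugeConfig 4 L G → ℝ} (hZ : MemLp Z 2 μ) (x : Site 4) :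
    cov[torusDensity r L x, Z; μ] - cov[reflDensity r L x, Z; μ] = ∑ j ∈ Finset.univ.filter (fun j : Fin 4 => 0 < j),
      (cov[torusPlaquette r L 0 j x, Z; μ] - cov[torusPlaquette r L 0 j (x - Pi.single 0 1), Z; μ]) := by
  have hP := fun z j => memLp_torusPlaquette r L 0 j z μ
  have hsub : torusDensity r L x - reflDensity r L x = fun U => ∑ j ∈ Finset.univ.filter (fun j : Fin 4 => 0 < j),
      (torusPlaquette r L 0 j x U - torusPlaquette r L 0 j (x - Pi.single 0 1) U) := funext fun U => by
    have h := reflDensity_sub_torusDensity r L x U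
    rw [Finset.sum_filter, Pi.sub_apply]
    linarith
  rw [← ProbabilityTheory.covariance_sub_left (memLp_torusDensity r L x μ).1 (memLp_torusDensity r L x μ).2 hZ, hsub,
    ProbabilityTheory.covariance_fun_sum_left' _ hZ]
  · exact Finset.sum_congr rfl fun j _ => ProbabilityTheory.covariance_fun_sub_left (hP x j) (hP _ j) hZ
  · exact fun j _ => (hP x j).sub (hP _ j)

/-- **`Cov(P_x, P_y) = reflPair(θ_ℤ x, y) + swap`**: `P_{θ_ℤ x} ∘ Θ = P̃_x` (`torusDensity_timeReflect`) makes `reflPair(θ_ℤ x, y) =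
Cov(P̃_x, P_y)`; the swap `Cov(P_x − P̃_x, P_y)` is expanded over `j > 0` and the six planes of `P_y` into differences of 2-string weights. -/
private theorem covariance_torusDensity_eq (r : LatticeRep G) (β : ℝ) (S : ℕ) (x y : Site 4) :
    cov[torusDensity r (2 * S + 1) x, torusDensity r (2 * S + 1) y; wilsonMeasure (d := 4) (L := 2 * S + 1) r.ρ β] =
      reflPair r β S (thetaZ x) y + ∑ t ∈ (Finset.univ.filter (fun j : Fin 4 => 0 < j)) ×ˢ
          (Finset.univ.filter (fun q : Fin 4 × Fin 4 => q.1 < q.2)),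
        (planeWeight r β S ![((0 : Fin 4), t.1), t.2] ![x, y] - planeWeight r β S ![((0 : Fin 4), t.1), t.2] ![x - Pi.single 0 1, y]) := by
  haveI : IsProbabilityMeasure (wilsonMeasure (d := 4) (L := 2 * S + 1) r.ρ β) := isProbabilityMeasure_wilsonMeasure r.ρ r.continuous β
  have hD := fun z => memLp_torusDensity r (2 * S + 1) z (wilsonMeasure (d := 4) (L := 2 * S + 1) r.ρ β)
  have hP := fun i j z => memLp_torusPlaquette r (2 * S + 1) i j z (wilsonMeasure (d := 4) (L := 2 * S + 1) r.ρ β)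
  have hrefl : reflPair r β S (thetaZ x) y = cov[reflDensity r (2 * S + 1) x, torusDensity r (2 * S + 1) y; wilsonMeasure r.ρ β] := by
    rw [ProbabilityTheory.covariance_eq_sub (hD x).2 (hD y).1]; unfold reflPair
    simp only [torusDensity_timeReflect, thetaZ_thetaZ, Pi.mul_apply]
  rw [hrefl, Finset.sum_product, ← sub_eq_iff_eq_add', covariance_torusDensity_sub r _ _ (hD y).1 x]
  refine Finset.sum_congr rfl fun j _ => ?_
  rw [covariance_torusDensity_right r _ _ (hP 0 j x) y, covariance_torusDensity_right r _ _ (hP 0 j _) y, ← Finset.sum_sub_distrib]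
  exact Finset.sum_congr rfl fun ⟨i', j'⟩ _ => by rw [covariance_torusPlaquette, covariance_torusPlaquette]

/-- The summand of `Q2` is the covariance of two torus densities. -/
private theorem torusE_sub_eq_covariance (r : LatticeRep G) (β : ℝ) (S : ℕ) (x y : Site 4) :
    torusE G r β S (fun U => dens G r x U * dens G r y U) - torusE G r β S (dens G r x) * torusE G r β S (dens G r y) =
      cov[torusDensity r (2 * S + 1) x, torusDensity r (2 * S + 1) y; wilsonMeasure (d := 4) (L := 2 * S + 1) r.ρ β] := by
  haveI := isProbabilityMeasure_wilsonMeasure (d := 4) (L := 2 * S + 1) r.ρ r.continuous β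
  rw [ProbabilityTheory.covariance_eq_sub (memLp_torusDensity r _ x _).1 (memLp_torusDensity r _ y _).1]
  rfl

/-- **`Q2 = main + swap` on the lattice**: the reflected-pair part `Σ_{x,y} f(ax) g(ay) reflPair(θ_ℤ x, y)` plus the swap, a sum
over `≤ 64` plane pairs of smeared differences of 2-string weights. -/
private theorem Q2_eq_main_add_swap (r : LatticeRep G) (β : ℝ) (S : ℕ) (a : ℝ) (f g : 𝓢((EuclideanSpace ℝ (Fin 4)), ℝ)) :
    Q2 G r β S a f g = (∑ x ∈ box 4 S, ∑ y ∈ box 4 S, f (a • siteToE x) * g (a • siteToE y) * reflPair r β S (thetaZ x) y) +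
      ∑ t ∈ (Finset.univ.filter (fun j : Fin 4 => 0 < j)) ×ˢ (Finset.univ.filter (fun q : Fin 4 × Fin 4 => q.1 < q.2)),
        ∑ x ∈ box 4 S, ∑ y ∈ box 4 S, f (a • siteToE x) * g (a • siteToE y) *
          (planeWeight r β S ![((0 : Fin 4), t.1), t.2] ![x, y] - planeWeight r β S ![((0 : Fin 4), t.1), t.2] ![x - Pi.single 0 1, y]) := by
  unfold Q2
  simp_rw [torusE_sub_eq_covariance, covariance_torusDensity_eq, mul_add, Finset.sum_add_distrib, Finset.mul_sum]
  congr 1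
  exact (Finset.sum_congr rfl fun x _ => Finset.sum_comm).trans Finset.sum_comm

/-- **Mean value along a vector**: `u (z + c) − u z = ∂_c u (z + τ c)`, `τ ∈ [0, 1]`, for a real Schwartz function. -/
private theorem exists_sub_eq_lineDeriv (u : 𝓢((EuclideanSpace ℝ (Fin 4)), ℝ)) (z c : (EuclideanSpace ℝ (Fin 4))) :
    ∃ τ ∈ Set.Icc (0 : ℝ) 1, u (z + c) - u z = (∂_{c} u : 𝓢((EuclideanSpace ℝ (Fin 4)), ℝ)) (z + τ • c) := by
  obtain ⟨ξ, hξ, h⟩ := domain_mvt (f := (u : (EuclideanSpace ℝ (Fin 4)) → ℝ)) (s := Set.univ) (x := z) (y := z + c)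
    (fun w _ => (u.hasFDerivAt w).hasFDerivWithinAt) convex_univ (Set.mem_univ _) (Set.mem_univ _)
  rw [segment_eq_image'] at hξ
  obtain ⟨τ, hτ, rfl⟩ := hξ
  exact ⟨τ, hτ, by rw [SchwartzMap.lineDerivOp_apply_eq_fderiv, h, add_sub_cancel_left]⟩

/-- **Summation by parts on the box, boundary-free**: if `w` vanishes at the lattice points with `|x₀| ≥ S`, the `e₀`-shift moves
from one factor to the other inside `box 4 S` (the slices entering and leaving carry no weight). -/
private theorem sum_box_mul_shift {S : ℕ} (w h : Site 4 → ℝ) (hw : ∀ x, w x ≠ 0 → -(S : ℤ) < x 0 ∧ x 0 < S) :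
    ∑ x ∈ box 4 S, w x * h (x - Pi.single 0 1) = ∑ x ∈ box 4 S, w (x + Pi.single 0 1) * h x := by
  -- membership in the box after a temporal unit step `x ↦ x + t e₀`, `t = ±1`
  have hbox : ∀ (x : Site 4) (t : ℤ), x ∈ box 4 S → -(S : ℤ) ≤ x 0 + t → x 0 + t ≤ S → x + Pi.single 0 t ∈ box 4 S := by
    intro x t hx hl hr
    rw [mem_box] at hx ⊢
    intro i; by_cases hi : i = 0
    · subst hi; simp only [Pi.add_apply, Pi.single_eq_same]; omega
    · simpa only [Pi.add_apply, Pi.single_eq_of_ne hi, add_zero] using hx i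
  refine Finset.sum_bij_ne_zero (fun x _ _ => x - Pi.single 0 1) (fun x hx hne => ?_) (fun x₁ _ _ x₂ _ _ h => by simpa using h)
    (fun b hb hne => ?_) (fun x _ _ => by simp)
  · obtain ⟨h1, -⟩ := hw x (left_ne_zero_of_mul hne)
    have hx0 := (mem_box.1 hx) 0
    have h := hbox x (-1) hx (by omega) (by omega); rwa [Pi.single_neg, ← sub_eq_add_neg] at h
  · obtain ⟨-, h2⟩ := hw _ (left_ne_zero_of_mul hne)
    simp only [Pi.add_apply, Pi.single_eq_same] at h2
    have hb0 := (mem_box.1 hb) 0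
    exact ⟨b + Pi.single 0 1, hbox b 1 hb (by omega) (by omega), by simpa using hne, by simp⟩

/-- **The swap term is `O(a)`.**  For a 2-string weight `W` obeying the bound `B` at shifted evaluation points against the FIXED tensor
`F = ∂₀u ⊗ v`, real `u` (no weight near the temporal faces of the box) and `v`: `|Σ_{x,y} u(ax) v(ay) (W(x, y) − W(x − e₀, y))| ≤ a a⁻⁸ B`
(summation by parts in `x`, mean value theorem for `u` along `e₀` over one spacing `a`, the bound at the intermediate points). -/
private theorem abs_sum_mul_sub_shift_le {a : ℝ} (ha : 0 < a) (S : ℕ) (u v : 𝓢((EuclideanSpace ℝ (Fin 4)), ℝ)) (F : 𝓢((Fin 2 → (EuclideanSpace ℝ (Fin 4))), ℂ))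
    (hF : ∀ z : Fin 2 → (EuclideanSpace ℝ (Fin 4)), F z = (((∂_{EuclideanSpace.single (0 : Fin 4) (1 : ℝ)} u : 𝓢((EuclideanSpace ℝ (Fin 4)), ℝ)) (z 0) : ℝ) : ℂ) * ((v (z 1) : ℝ) : ℂ))
    (hu : ∀ x : Site 4, u (a • siteToE x) ≠ 0 → -(S : ℤ) < x 0 ∧ x 0 < S) (W : (Fin 2 → Site 4) → ℝ) (B : ℝ)
    (hB : ∀ Y : (Fin 2 → Site 4) → (Fin 2 → (EuclideanSpace ℝ (Fin 4))), (∀ z l, ‖Y z l - a • siteToE (z l)‖ ≤ 6 * a) →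
      a ^ (4 * 2) * ‖∑ z ∈ Fintype.piFinset (fun _ : Fin 2 => box 4 S), ((W z : ℝ) : ℂ) * F (Y z)‖ ≤ B) :
    |∑ x ∈ box 4 S, ∑ y ∈ box 4 S, u (a • siteToE x) * v (a • siteToE y) * (W ![x, y] - W ![x - Pi.single 0 1, y])| ≤
      a * (a ^ (4 * 2))⁻¹ * B := by
  -- one lattice step in physical units; the mean value theorem, pointwise in `x`
  have he : ∀ x : Site 4, a • siteToE (x + Pi.single 0 1) = a • siteToE x + a • EuclideanSpace.single (0 : Fin 4) (1 : ℝ) := by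
    intro x; rw [← smul_add]; congr 1; ext j; by_cases hj : j = 0 <;> simp [siteToE_apply, hj]
  have hmvt : ∀ x : Site 4, ∃ τ ∈ Set.Icc (0 : ℝ) 1, u (a • siteToE (x + Pi.single 0 1)) - u (a • siteToE x) =
      a * (∂_{EuclideanSpace.single (0 : Fin 4) (1 : ℝ)} u : 𝓢((EuclideanSpace ℝ (Fin 4)), ℝ)) (a • siteToE x + τ • (a • EuclideanSpace.single (0 : Fin 4) (1 : ℝ))) :=
    fun x => by
      obtain ⟨τ, hτ, h⟩ := exists_sub_eq_lineDeriv u (a • siteToE x) (a • EuclideanSpace.single (0 : Fin 4) (1 : ℝ))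
      exact ⟨τ, hτ, by rw [he, h, LineDeriv.lineDerivOp_left_smul, smul_apply, smul_eq_mul]⟩
  choose τ hτ hτeq using hmvt
  obtain ⟨ξ, hξ⟩ : ∃ ξ : Site 4 → (EuclideanSpace ℝ (Fin 4)), ∀ x, ξ x = a • siteToE x + τ x • (a • EuclideanSpace.single (0 : Fin 4) (1 : ℝ)) := ⟨_, fun x => rfl⟩
  -- summation by parts in `x`
  have hsum : ∑ x ∈ box 4 S, ∑ y ∈ box 4 S, u (a • siteToE x) * v (a • siteToE y) * (W ![x, y] - W ![x - Pi.single 0 1, y]) =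
      -(a * ∑ x ∈ box 4 S, ∑ y ∈ box 4 S,
        W ![x, y] * ((∂_{EuclideanSpace.single (0 : Fin 4) (1 : ℝ)} u : 𝓢((EuclideanSpace ℝ (Fin 4)), ℝ)) (ξ x) * v (a • siteToE y))) := by
    have h1 : ∀ x, ∑ y ∈ box 4 S, u (a • siteToE x) * v (a • siteToE y) * (W ![x, y] - W ![x - Pi.single 0 1, y]) =
        u (a • siteToE x) * ∑ y ∈ box 4 S, v (a • siteToE y) * W ![x, y] -
          u (a • siteToE x) * ∑ y ∈ box 4 S, v (a • siteToE y) * W ![x - Pi.single 0 1, y] := fun x => by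
      rw [Finset.mul_sum, Finset.mul_sum, ← Finset.sum_sub_distrib]; exact Finset.sum_congr rfl fun y _ => by ring
    rw [Finset.sum_congr rfl fun x _ => h1 x, Finset.sum_sub_distrib,
      sum_box_mul_shift (fun x => u (a • siteToE x)) (fun x => ∑ y ∈ box 4 S, v (a • siteToE y) * W ![x, y]) hu,
      ← Finset.sum_sub_distrib, Finset.mul_sum, ← Finset.sum_neg_distrib]
    refine Finset.sum_congr rfl fun x _ => ?_
    beta_reduce
    rw [← sub_mul, show u (a • siteToE x) - u (a • siteToE (x + Pi.single 0 1)) =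
      -(a * (∂_{EuclideanSpace.single (0 : Fin 4) (1 : ℝ)} u : 𝓢((EuclideanSpace ℝ (Fin 4)), ℝ)) (ξ x)) by rw [hξ x]; linarith [hτeq x],
      Finset.mul_sum, Finset.mul_sum, ← Finset.sum_neg_distrib]
    exact Finset.sum_congr rfl fun y _ => by ring
  -- the evaluation map (within `a` of the lattice points) and the bound
  obtain ⟨Y, hY0, hY1⟩ : ∃ Y : (Fin 2 → Site 4) → (Fin 2 → (EuclideanSpace ℝ (Fin 4))), (∀ z, Y z 0 = ξ (z 0)) ∧ ∀ z, Y z 1 = a • siteToE (z 1) :=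
    ⟨fun z => ![ξ (z 0), a • siteToE (z 1)], fun z => rfl, fun z => rfl⟩
  have hYa : ∀ z l, ‖Y z l - a • siteToE (z l)‖ ≤ 6 * a := fun z => Fin.forall_fin_two.2 ⟨by
    rw [hY0, hξ, add_sub_cancel_left, norm_smul, norm_smul, Real.norm_of_nonneg (hτ (z 0)).1, Real.norm_of_nonneg ha.le,
      PiLp.norm_single, norm_one, mul_one]
    nlinarith [(hτ (z 0)).2, (hτ (z 0)).1], by rw [hY1, sub_self, norm_zero]; positivity⟩
  have hcplx : (((∑ x ∈ box 4 S, ∑ y ∈ box 4 S,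
      W ![x, y] * ((∂_{EuclideanSpace.single (0 : Fin 4) (1 : ℝ)} u : 𝓢((EuclideanSpace ℝ (Fin 4)), ℝ)) (ξ x) * v (a • siteToE y)) : ℝ)) : ℂ) =
      ∑ z ∈ Fintype.piFinset (fun _ : Fin 2 => box 4 S), ((W z : ℝ) : ℂ) * F (Y z) := by
    rw [sum_piFinset_two]; push_cast
    exact Finset.sum_congr rfl fun x _ => Finset.sum_congr rfl fun y _ => by rw [hF, hY0, hY1]; simp
  have hbound := hB Y hYa
  rw [← hcplx, Complex.norm_real, Real.norm_eq_abs] at hbound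
  rw [hsum, abs_neg, abs_mul, abs_of_pos ha, mul_assoc]
  exact mul_le_mul_of_nonneg_left (by rwa [inv_mul_eq_div, le_div_iff₀ (pow_pos ha _), mul_comm]) ha.le

/-- SG5 (worker): the lattice lower bound — cone comparability (W2b) at the normalisation height `R₀ = ⌊δ₀/a⌋₊` plus the a-uniform
bound for 2-strings of plane weights (shape of (U) at `n = 2`) give, for ONE fixed positive-time bump `v` (depending on `δ₀, θ` only),
a floor `ε ≤ N⁻¹ a⁸ Q2(θv, v)` on every admissible step (`a ≤ a₀`, `Λ₀ ≤ a S`): `v` = bump centred at `(1 + θ/2)δ₀ e₀`, plateau radius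
`ρ = θδ₀/8`; `ε = c ρ⁸ / 512`; `Λ₀ = (1 + θ)δ₀ + 1`. -/
theorem scaledQ2_lower_bound :
    ∀ (δ₀ θ c K : ℝ) (γ s : ℕ), 0 < δ₀ → 0 < θ → 0 < c → 0 ≤ K →
      ∃ (v : 𝓢(EuclideanSpace ℝ (Fin 4), ℝ)) (ε a₀ Λ₀ : ℝ), 0 < ε ∧ 0 < a₀ ∧
        tsupport v ⊆ {y : EuclideanSpace ℝ (Fin 4) | 0 < y 0} ∧
        ∀ (G : Type) [Group G] [TopologicalSpace G] [IsTopologicalGroup G] [CompactSpace G] [MeasurableSpace G]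
          [BorelSpace G] (r : LatticeRep G) (β : ℝ) (S : ℕ) (a : ℝ), 0 < a → a ≤ a₀ → Λ₀ ≤ a * S →
          0 < rpSquare r β S ⌊δ₀ / a⌋₊ →
          (∀ x y : Site 4, (⌊δ₀ / a⌋₊ : ℝ) ≤ x 0 → (x 0 : ℝ) ≤ (1 + θ) * ⌊δ₀ / a⌋₊ →
            (⌊δ₀ / a⌋₊ : ℝ) ≤ y 0 → (y 0 : ℝ) ≤ (1 + θ) * ⌊δ₀ / a⌋₊ →
            (∀ i : Fin 4, i ≠ 0 → (|x i - y i| : ℝ) ≤ θ * ⌊δ₀ / a⌋₊) →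
              c * rpSquare r β S ⌊δ₀ / a⌋₊ ≤ reflPair r β S x y) →
          (∀ (q : Fin 2 → Fin 4 × Fin 4), (∀ i, (q i).1 ≠ (q i).2) →
            ∀ (y : (Fin 2 → Site 4) → (Fin 2 → EuclideanSpace ℝ (Fin 4))),
              (∀ x l, ‖y x l - a • siteToE (x l)‖ ≤ 6 * a) →
              ∀ F : 𝓢((Fin 2 → EuclideanSpace ℝ (Fin 4)), ℂ), IsOffDiagonal F →
                a ^ (4 * 2) * ‖∑ x ∈ Fintype.piFinset (fun _ : Fin 2 => box 4 S),
                    ((planeWeight r β S q x : ℝ) : ℂ) * F (y x)‖ ≤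
                  (K * (2 : ℝ) ^ γ * Real.sqrt (rpSquare r β S ⌊δ₀ / a⌋₊)) ^ 2 * schwartzNorm (s * 2) F) →
          ε ≤ (rpSquare r β S ⌊δ₀ / a⌋₊)⁻¹ * a ^ 8 * Q2 G r β S a (thetaTest 4 v) v := by
  intro δ₀ θ c K γ s hδ₀ hθ hc hK
  -- the bump `v`: centre `T e₀`, `T = (1 + θ/2) δ₀`, plateau radius `ρ = θ δ₀ / 8`, support radius `2ρ = θ δ₀ / 4`
  obtain ⟨ρ, hρ⟩ : ∃ ρ : ℝ, ρ = θ * δ₀ / 8 := ⟨_, rfl⟩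
  obtain ⟨T, hT⟩ : ∃ T : ℝ, T = (1 + θ / 2) * δ₀ := ⟨_, rfl⟩
  have hθδ : 0 < θ * δ₀ := mul_pos hθ hδ₀
  have hρ0 : 0 < ρ := by rw [hρ]; positivity
  have hT0 : 0 < T := by rw [hT]; positivity
  obtain ⟨v, hv0, -, hvone, hvsupp, hvts⟩ := exists_bump_schwartz (EuclideanSpace.single (0 : Fin 4) T) hρ0
  have hco : ∀ z : (EuclideanSpace ℝ (Fin 4)), v z ≠ 0 → |z 0 - T| < θ * δ₀ / 4 ∧ ∀ i : Fin 4, i ≠ 0 → |z i| < θ * δ₀ / 4 := by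
    intro z hz
    have hn : ‖z - EuclideanSpace.single 0 T‖ < θ * δ₀ / 4 := by
      rw [← dist_eq_norm, show θ * δ₀ / 4 = 2 * ρ by rw [hρ]; ring]; exact hvsupp z hz
    refine ⟨lt_of_le_of_lt ?_ hn, fun i hi => lt_of_le_of_lt ?_ hn⟩
    · rw [← show (z - EuclideanSpace.single 0 T : (EuclideanSpace ℝ (Fin 4))) 0 = z 0 - T by simp]; exact abs_apply_le_norm _ 0
    · rw [← show (z - EuclideanSpace.single 0 T : (EuclideanSpace ℝ (Fin 4))) i = z i by simp [hi]]; exact abs_apply_le_norm _ i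
  -- the reflected bump `u = v ∘ θ`, its temporal derivative `du`, the off-diagonal tensor `F = du ⊗ v`
  set u : 𝓢((EuclideanSpace ℝ (Fin 4)), ℝ) := thetaTest 4 v with hu
  have hu_apply : ∀ z, u z = v (timeReflection 4 z) := fun z => by rw [hu, thetaTest_apply]
  set du : 𝓢((EuclideanSpace ℝ (Fin 4)), ℝ) := (∂_{EuclideanSpace.single (0 : Fin 4) (1 : ℝ)} u : 𝓢((EuclideanSpace ℝ (Fin 4)), ℝ)) with hdu
  set F : 𝓢((Fin 2 → (EuclideanSpace ℝ (Fin 4))), ℂ) := tensor₂ du v with hFdef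
  have hF : ∀ z : Fin 2 → (EuclideanSpace ℝ (Fin 4)), F z = ((du (z 0) : ℝ) : ℂ) * ((v (z 1) : ℝ) : ℂ) := fun z => tensor₂_apply du v z
  have hv_ts : tsupport v ⊆ {y : (EuclideanSpace ℝ (Fin 4)) | 0 < y 0} := by
    rw [hvts]; intro y hy
    rw [Metric.mem_closedBall, dist_eq_norm] at hy
    have h2 : |y 0 - T| ≤ 2 * ρ := by simpa using (abs_apply_le_norm (y - EuclideanSpace.single 0 T) 0).trans hy
    have h3 := (abs_le.1 h2).1; rw [hT] at h3; rw [hρ] at h3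
    show 0 < y 0; linarith
  have hu_ts : tsupport u ⊆ {y : (EuclideanSpace ℝ (Fin 4)) | y 0 < 0} := by
    have hsub : Function.support u ⊆ (timeReflection 4) ⁻¹' tsupport v := fun y hy => by
      rw [Function.mem_support, hu_apply] at hy; exact subset_tsupport _ (Function.mem_support.2 hy)
    refine (closure_minimal hsub ((isClosed_tsupport _).preimage (timeReflection 4).continuous)).trans fun y hy => ?_
    have h := hv_ts hy
    simp only [Set.mem_setOf_eq, timeReflection_apply] at h
    simpa using h
  have hFoff : IsOffDiagonal F :=
    isOffDiagonal_of_halfSpaces ((SchwartzMap.tsupport_lineDerivOp_subset _ u).trans hu_ts) hv_ts (isTensorOf_tensor₂ du v)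
  -- constants: `ε = c ρ⁸/512`; `a₀` makes the cone, the plateaux and the swap estimate work; `Λ₀ = (1 + θ) δ₀ + 1`
  have hCF0 : 0 ≤ schwartzNorm (s * 2) F := schwartzNorm_nonneg _ _
  set Bsw : ℝ := (K * 2 ^ γ) ^ 2 * schwartzNorm (s * 2) F with hBsw
  have hBsw0 : 0 ≤ Bsw := by positivity
  refine ⟨v, c * ρ ^ 8 / 512, min (min (δ₀ / 2) (ρ / 2)) (min (θ * δ₀ / (16 + 8 * θ)) (c * ρ ^ 8 / (512 * (64 * Bsw + 1)))),
    (1 + θ) * δ₀ + 1, by positivity, by positivity, hv_ts, ?_⟩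
  intro G _ _ _ _ _ _ r β S a ha ha₀ hΛ hN HW2b HU
  have haδ : a ≤ δ₀ / 2 := ha₀.trans ((min_le_left _ _).trans (min_le_left _ _))
  have haρ : 2 * a ≤ ρ := by linarith [ha₀.trans ((min_le_left _ _).trans (min_le_right _ _))]
  have haθ : (16 + 8 * θ) * a ≤ θ * δ₀ := by rw [mul_comm]; exact (le_div_iff₀ (by positivity)).1 (ha₀.trans ((min_le_right _ _).trans (min_le_left _ _)))
  have haC : a * (64 * Bsw + 1) ≤ c * ρ ^ 8 / 512 := by
    have h := (le_div_iff₀ (by positivity)).1 (ha₀.trans ((min_le_right _ _).trans (min_le_right _ _)))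
    calc a * (64 * Bsw + 1) = a * (512 * (64 * Bsw + 1)) / 512 := by ring
      _ ≤ c * ρ ^ 8 / 512 := by gcongr
  -- `R₀ = ⌊δ₀/a⌋`, `N = rpSquare r β S R₀`
  obtain ⟨R₀, hR₀⟩ : ∃ R₀ : ℕ, R₀ = ⌊δ₀ / a⌋₊ := ⟨_, rfl⟩
  rw [← hR₀] at hN HW2b HU ⊢
  obtain ⟨N, hNdef⟩ : ∃ N : ℝ, N = rpSquare r β S R₀ := ⟨_, rfl⟩
  rw [← hNdef] at hN HW2b HU ⊢
  have hN0 : N ≠ 0 := hN.ne'; have ha0 : a ≠ 0 := ha.ne'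
  have hR₀le : (R₀ : ℝ) * a ≤ δ₀ := by rw [hR₀, ← le_div_iff₀ ha]; exact Nat.floor_le (by positivity)
  have hR₀gt : δ₀ - a < (R₀ : ℝ) * a := by have h := Nat.lt_floor_add_one (δ₀ / a); rw [← hR₀, div_lt_iff₀ ha] at h; linarith
  have hθR : θ * (δ₀ - a) < θ * ((R₀ : ℝ) * a) := mul_lt_mul_of_pos_left hR₀gt hθ
  have h1θR : (1 + θ) * (δ₀ - a) < (1 + θ) * ((R₀ : ℝ) * a) := mul_lt_mul_of_pos_left hR₀gt (by positivity)
  have hθa : θ * a ≤ θ * (δ₀ / 2) := mul_le_mul_of_nonneg_left haδ hθ.le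
  -- coordinates of the weighted lattice points `a y` (`v(ay) ≠ 0`) and `θ(a x)` (`u(ax) ≠ 0`)
  have ey : ∀ (y : Site 4) (i : Fin 4), (a • siteToE y) i = a * (y i : ℝ) := fun y i => by simp [siteToE_apply]
  have ex0 : ∀ x : Site 4, (timeReflection 4 (a • siteToE x)) 0 = -(a * (x 0 : ℝ)) := fun x => by simp [timeReflection_apply, siteToE_apply]
  have exi : ∀ (x : Site 4) (i : Fin 4), i ≠ 0 → (timeReflection 4 (a • siteToE x)) i = a * (x i : ℝ) := fun x i hi => by
    simp [timeReflection_apply, siteToE_apply, hi]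
  have hu_box : ∀ x : Site 4, u (a • siteToE x) ≠ 0 → -(S : ℤ) < x 0 ∧ x 0 < S := by
    intro x hx
    rw [hu_apply] at hx
    have hx0 := (hco _ hx).1; rw [ex0, abs_lt] at hx0
    have h1 : ((x 0 : ℤ) : ℝ) < S := lt_of_mul_lt_mul_right (by linarith [hx0.1, hΛ, hT, hθδ, hδ₀]) ha.le
    have h2 : -(S : ℝ) < ((x 0 : ℤ) : ℝ) := lt_of_mul_lt_mul_right (by linarith [hx0.2, hΛ, hT, hθδ]) ha.le
    exact ⟨by exact_mod_cast h2, by exact_mod_cast h1⟩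
  -- (W2b): every weighted pair `(θ_ℤ x, y)` lies in the cone at height `R₀`
  have key : ∀ x y : Site 4, u (a • siteToE x) ≠ 0 → v (a • siteToE y) ≠ 0 → c * N ≤ reflPair r β S (thetaZ x) y := by
    intro x y hx hy
    rw [hu_apply] at hx
    obtain ⟨hx0, hxi⟩ := hco _ hx; rw [ex0, abs_lt] at hx0
    obtain ⟨hy0, hyi⟩ := hco _ hy; rw [ey, abs_lt] at hy0
    refine HW2b (thetaZ x) y ?_ ?_ (le_of_mul_le_mul_right (by linarith [hy0.1, hR₀le, hθδ, hT]) ha)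
      (le_of_mul_le_mul_right (by linarith [hy0.2, h1θR, haθ, ha, hθδ, hT]) ha) fun i hi => ?_
    · rw [thetaZ_apply_zero]; push_cast; exact le_of_mul_le_mul_right (by linarith [hx0.1, hR₀le, hθδ, ha, hT]) ha
    · rw [thetaZ_apply_zero]; push_cast; exact le_of_mul_le_mul_right (by linarith [hx0.2, h1θR, haθ, hT, hθδ, ha]) ha
    · have h1 := hxi i hi; rw [exi x i hi] at h1
      have h2 := hyi i hi; rw [ey] at h2
      rw [thetaZ_apply_of_ne x hi]; refine le_of_mul_le_mul_right ?_ ha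
      rw [show |(x i : ℝ) - y i| * a = |a * x i - a * y i| by rw [← mul_sub, abs_mul, abs_of_pos ha, mul_comm]]
      linarith [abs_sub (a * (x i : ℝ)) (a * y i), hθR, hθa]
  -- Riemann mass of the two plateaux, and the main term
  have hcover : ∀ j : Fin 4, |(EuclideanSpace.single (0 : Fin 4) T : (EuclideanSpace ℝ (Fin 4))) j| + ρ ≤ a * S := fun j => by
    have h1 : |(EuclideanSpace.single (0 : Fin 4) T : (EuclideanSpace ℝ (Fin 4))) j| ≤ T := by rw [PiLp.single_apply]; split_ifs <;> simp [abs_of_pos hT0, hT0.le]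
    linarith [h1, hΛ, hT, hρ, hθδ]
  have hSy : (ρ / (2 * a)) ^ 4 ≤ ∑ y ∈ box 4 S, v (a • siteToE y) := pow_le_sum_box hv0 ha (fun z hz => hvone z hz) haρ hcover
  have hSx : (ρ / (2 * a)) ^ 4 ≤ ∑ x ∈ box 4 S, u (a • siteToE x) := by
    refine pow_le_sum_box (p := -EuclideanSpace.single (0 : Fin 4) T) (fun z => ?_) ha (fun z hz => ?_) haρ
      (fun j => by simpa using hcover j)
    · rw [hu_apply]; exact hv0 _
    · rw [hu_apply]; refine hvone _ ?_
      rwa [dist_eq_norm, norm_timeReflection_sub_single, ← sub_neg_eq_add, ← dist_eq_norm]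
  have hmain : c * N * (ρ / (2 * a)) ^ 8 ≤
      ∑ x ∈ box 4 S, ∑ y ∈ box 4 S, u (a • siteToE x) * v (a • siteToE y) * reflPair r β S (thetaZ x) y := by
    refine le_trans ?_ (mul_sum_mul_sum_le (B := box 4 S) (κ := c * N) (f := fun x => u (a • siteToE x))
      (g := fun y => v (a • siteToE y)) (C := fun x y => reflPair r β S (thetaZ x) y)
      (fun x => by simp only [hu_apply]; exact hv0 _) (fun y => hv0 _) key)
    calc c * N * (ρ / (2 * a)) ^ 8 = c * N * ((ρ / (2 * a)) ^ 4 * (ρ / (2 * a)) ^ 4) := by ring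
      _ ≤ c * N * ((∑ x ∈ box 4 S, u (a • siteToE x)) * ∑ y ∈ box 4 S, v (a • siteToE y)) :=
          mul_le_mul_of_nonneg_left (mul_le_mul hSx hSy (by positivity) (le_trans (by positivity) hSx)) (by positivity)
  -- the swap: `≤ 64` terms, each `O(a · a⁻⁸ N)` by (U) at `n = 2` against `F = du ⊗ v`
  obtain ⟨P, hP⟩ : ∃ P : Finset (Fin 4 × (Fin 4 × Fin 4)),
      P = (Finset.univ.filter (fun j : Fin 4 => 0 < j)) ×ˢ (Finset.univ.filter (fun q : Fin 4 × Fin 4 => q.1 < q.2)) := ⟨_, rfl⟩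
  have hterm : ∀ t ∈ P, |∑ x ∈ box 4 S, ∑ y ∈ box 4 S, u (a • siteToE x) * v (a • siteToE y) *
      (planeWeight r β S ![((0 : Fin 4), t.1), t.2] ![x, y] - planeWeight r β S ![((0 : Fin 4), t.1), t.2] ![x - Pi.single 0 1, y])| ≤
        a * (a ^ (4 * 2))⁻¹ * ((K * (2 : ℝ) ^ γ * Real.sqrt N) ^ 2 * schwartzNorm (s * 2) F) := by
    rintro ⟨j, q⟩ ht
    simp only [hP, Finset.mem_product, Finset.mem_filter, Finset.mem_univ, true_and] at ht
    have hq : ∀ i : Fin 2, ((![((0 : Fin 4), j), q] : Fin 2 → Fin 4 × Fin 4) i).1 ≠ ((![((0 : Fin 4), j), q] : Fin 2 → Fin 4 × Fin 4) i).2 :=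
      Fin.forall_fin_two.2 ⟨by simpa using ht.1.ne, by simpa using ht.2.ne⟩
    exact abs_sum_mul_sub_shift_le ha S u v F hF hu_box (planeWeight r β S ![((0 : Fin 4), j), q]) _ fun Y hY => HU _ hq Y hY F hFoff
  have hswap : |∑ t ∈ P, ∑ x ∈ box 4 S, ∑ y ∈ box 4 S, u (a • siteToE x) * v (a • siteToE y) *
      (planeWeight r β S ![((0 : Fin 4), t.1), t.2] ![x, y] - planeWeight r β S ![((0 : Fin 4), t.1), t.2] ![x - Pi.single 0 1, y])| ≤
        64 * (a * (a ^ (4 * 2))⁻¹ * ((K * (2 : ℝ) ^ γ * Real.sqrt N) ^ 2 * schwartzNorm (s * 2) F)) := by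
    refine (Finset.abs_sum_le_sum_abs _ _).trans ((Finset.sum_le_sum hterm).trans ?_)
    rw [Finset.sum_const, nsmul_eq_mul]
    refine mul_le_mul_of_nonneg_right ?_ (by positivity)
    exact_mod_cast (Finset.card_le_univ P).trans_eq (show Fintype.card (Fin 4 × (Fin 4 × Fin 4)) = 64 by simp)
  -- conclusion: `Q2 = main + swap`, `N⁻¹ a⁸ · main ≥ c ρ⁸ / 256`, `N⁻¹ a⁸ · |swap| ≤ 64 a Bsw ≤ c ρ⁸ / 512 − a`
  rw [Q2_eq_main_add_swap, ← hP]
  have hinv : (0 : ℝ) ≤ N⁻¹ * a ^ 8 := by positivity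
  have h1 := mul_le_mul_of_nonneg_left hmain hinv
  have h2 := mul_le_mul_of_nonneg_left ((neg_le_neg hswap).trans (neg_abs_le _)) hinv
  have e1 : N⁻¹ * a ^ 8 * (c * N * (ρ / (2 * a)) ^ 8) = c * ρ ^ 8 / 256 := by field_simp; ring
  have e2 : N⁻¹ * a ^ 8 * (64 * (a * (a ^ (4 * 2))⁻¹ * ((K * (2 : ℝ) ^ γ * Real.sqrt N) ^ 2 * schwartzNorm (s * 2) F))) =
      64 * a * Bsw := by rw [mul_pow, Real.sq_sqrt hN.le, hBsw]; field_simp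
  rw [mul_add]
  linarith [h1, h2, e1, e2, haC]

end Summit.QuantumFields.YangMills.Cruxes.HypercubicLimit.ConditionalMeanTelescoping

end
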